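import Summits.AtomisticToContinuum.Crystallization.Theorems.FrustratedLawDichotomyTextureUniformVerdict

/-!
# FrustratedLawDichotomy · crux `AperiodicFrustratedLawGap` (stmt-AtomisticToContinuum-27623) — VERDICT PROPAGATION across overlapping coherent
# windows: `hflip` with `R' := ρ + 1` from window-local verdicts (decomp-a2c lens-5 g111; FINDING «R₈/R₉ are bound inside the crux»)

Why this file exists.  In the served decl the texture radii occur only as the HYPOTHESIS `(∃ R₇ R₈ R₉, ∀ᵐ μ ∂P, Appr μ R₇ R₈ R₉)`, introduced after
`δ` and `P`, while the texture door `…SignedLedgerTextureDoor` fixes the coherent class `C δ` before `P`: the coherent window radius `R_c` of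
`C δ = ⋃ coherentAt (net i) τ₀ R_c` is a CONSTANT and cannot dominate `R₉`.  The free radii of `…TextureIncoherence.exists_incoherent_atom_of_apprM`
(`R, ρ, R', ε`) ARE chosen after `R₈ R₉`; so the uniform `1/8`-verdict on the `ρ`-ball (`ρ ≥ max (R₈, R₉)`) that `hflip` must deliver has to come
from MANY coherent atoms (`‖p‖ ≤ R' := ρ + O(1)`), each contributing the verdict on its OWN bounded window, glued along chains.  This file is that
glue, at SET level and fully abstract (atoms `S ∋ 0`, an abstract verdict `V : E3 → Prop` attached to atoms — in the application `V p` := «the host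
template atom `p` is coherent with is GOOD» — and an abstract site predicate `G : Fin N → Prop` — in the application `G j := Gy (1/8) N y j`):

* ★ `iff_root_of_locallyConstant_of_cover` — PROPAGATION: if `V` is constant on pairs of atoms of `closedBall 0 R'` at distance `≤ h + 2c`
  (`hloc`) and around every atom `q` of that ball every point within `h + c` of `q` has an atom within `c` (`hcov`: the covering radius of the
  lattice templates transported through the coherent window, `h + c + c ≤` window), then `V q ↔ V 0` for every atom `q` with `‖q‖ ≤ R'`
  (induction on `⌈‖q‖/h⌉`: step back from `q` by `h + c` towards the origin, pick the atom within `c`).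
* ★ `locallyConstant_of_windowVerdict` — `hloc` from WINDOW VERDICTS: if every atom `p` of the ball decides `G` on all sites matched to atoms
  within `L` of `p` (`hwin`: this is `…TextureFlipGood.gy_eighth_of_template_matched` / `…TextureFlipBad.not_gy_eighth_of_badTemplate` applied to
  the re-rooted configuration `S − p` and its host template), then `V` is constant on pairs at distance `≤ L`.
* ★ `uniformVerdict_of_rootConstant` / ★ `uniformVerdict_of_windowVerdict_of_cover` — the `hflip` DISJUNCTION of
  `…TextureIncoherence.exists_incoherent_atom_of_apprM` with `R' ≥ ρ + ε`: `(∀ j, dist (y j) (y i) ≤ ρ → G j) ∨ (∀ j, dist (y j) (y i) ≤ ρ → ¬ G j)`.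
[folklore: induction + logic]; no definitions, no `sorry`, no instances, no notation.
-/

noncomputable section

namespace Summit.AtomisticToContinuum.Crystallization.Theorems.FrustratedLawDichotomyTexturePropagation

open Metric Set

/-- ★ **PROPAGATION along chains of atoms.**  `V` locally constant on the atoms of `closedBall 0 R'` at range `h + 2c` and atoms `c`-dense within
`h + c` of every atom of that ball ⇒ `V q ↔ V 0` for every atom `q` with `‖q‖ ≤ R'`. [folklore] -/
theorem iff_root_of_locallyConstant_of_cover
    {S : Set (EuclideanSpace ℝ (Fin 3))} {V : EuclideanSpace ℝ (Fin 3) → Prop} {h c R' : ℝ} (hh : 0 < h) (hc : 0 ≤ c)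
    (h0 : (0 : EuclideanSpace ℝ (Fin 3)) ∈ S) (hR' : 0 ≤ R')
    (hloc : ∀ p ∈ S, ∀ q ∈ S, ‖p‖ ≤ R' → ‖q‖ ≤ R' → dist p q ≤ h + 2 * c → (V p ↔ V q))
    (hcov : ∀ q ∈ S, ‖q‖ ≤ R' → ∀ w : EuclideanSpace ℝ (Fin 3), dist w q ≤ h + c → ∃ p ∈ S, dist p w ≤ c) :
    ∀ q ∈ S, ‖q‖ ≤ R' → (V q ↔ V 0) := by
  have key : ∀ n : ℕ, ∀ q ∈ S, ‖q‖ ≤ R' → ‖q‖ ≤ h + 2 * c + (n : ℝ) * h → (V q ↔ V 0) := by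
    intro n
    induction n with
    | zero =>
      intro q hq hqR hqn
      have h1 : dist (0 : EuclideanSpace ℝ (Fin 3)) q ≤ h + 2 * c := by
        rw [dist_comm, dist_zero_right]; simpa using hqn
      exact (hloc 0 h0 q hq (by rw [norm_zero]; exact hR') hqR h1).symm
    | succ n ih =>
      intro q hq hqR hqn
      push_cast at hqn
      by_cases hle : ‖q‖ ≤ h + 2 * c + (n : ℝ) * h
      · exact ih q hq hqR hle
      · have hn0 : (0 : ℝ) ≤ (n : ℝ) * h := mul_nonneg (Nat.cast_nonneg n) hh.le
        have hqbig : h + c < ‖q‖ := by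
          have := lt_of_not_ge hle
          linarith
        have hnq : 0 < ‖q‖ := by linarith
        set t : ℝ := (h + c) / ‖q‖ with ht
        have ht0 : 0 ≤ t := div_nonneg (by linarith) hnq.le
        have ht1 : t ≤ 1 := by rw [ht, div_le_one hnq]; exact hqbig.le
        have htq : t * ‖q‖ = h + c := div_mul_cancel₀ _ hnq.ne'
        set w : EuclideanSpace ℝ (Fin 3) := (1 - t) • q with hw
        have hwq : dist w q = h + c := by
          have h1 : w - q = -(t • q) := by rw [hw, sub_smul, one_smul]; abel
          rw [dist_eq_norm, h1, norm_neg, norm_smul, Real.norm_eq_abs, abs_of_nonneg ht0, htq]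
        have hwn : ‖w‖ = ‖q‖ - (h + c) := by
          rw [hw, norm_smul, Real.norm_eq_abs, abs_of_nonneg (by linarith), sub_mul, one_mul, htq]
        obtain ⟨p, hp, hpw⟩ := hcov q hq hqR w hwq.le
        have hpn : ‖p‖ ≤ ‖q‖ - h := by
          have h1 : ‖p‖ ≤ ‖w‖ + ‖p - w‖ := by
            have := norm_add_le w (p - w); rwa [add_sub_cancel] at this
          rw [← dist_eq_norm] at h1
          linarith
        have hpR : ‖p‖ ≤ R' := by linarith
        have hpq : dist p q ≤ h + 2 * c := by
          have := dist_triangle p w q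
          linarith
        exact (hloc p hp q hq hpR hqR hpq).symm.trans (ih p hp hpR (by linarith))
  intro q hq hqR
  obtain ⟨n, hn⟩ := exists_nat_ge (‖q‖ / h)
  refine key n q hq hqR ?_
  have h1 : ‖q‖ ≤ (n : ℝ) * h := by rwa [div_le_iff₀ hh] at hn
  linarith

/-- ★ **Local constancy of the host verdict from window verdicts.**  If every atom `p` of `closedBall 0 R'` decides the site predicate `G` on all
sites `j` matched (tolerance `ε`, around `(y i, 0)`) to atoms within `L` of `p` — `G j ↔ V p` — and every atom of `closedBall 0 R` is matched
(`hm1`, `R' ≤ R`, `0 ≤ L`), then `V p ↔ V q` for atoms `p, q` of the `R'`-ball at distance `≤ L`. [folklore: logic] -/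
theorem locallyConstant_of_windowVerdict
    {S : Set (EuclideanSpace ℝ (Fin 3))} {V : EuclideanSpace ℝ (Fin 3) → Prop}
    {N : ℕ} {y : Fin N → EuclideanSpace ℝ (Fin 3)} {i : Fin N} {G : Fin N → Prop} {R R' ε L : ℝ}
    (hm1 : ∀ q ∈ S, dist q (0 : EuclideanSpace ℝ (Fin 3)) ≤ R → ∃ b : Fin N, dist (y b - y i) (q - 0) ≤ ε) (hR'R : R' ≤ R) (hL : 0 ≤ L)
    (hwin : ∀ p ∈ S, ‖p‖ ≤ R' → ∀ q ∈ S, dist p q ≤ L → ∀ j : Fin N, dist (y j - y i) (q - 0) ≤ ε → (G j ↔ V p)) :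
    ∀ p ∈ S, ∀ q ∈ S, ‖p‖ ≤ R' → ‖q‖ ≤ R' → dist p q ≤ L → (V p ↔ V q) := by
  intro p hp q hq hpR hqR hpq
  obtain ⟨j, hj⟩ := hm1 q hq (by rw [dist_zero_right]; linarith)
  have h1 := hwin p hp hpR q hq hpq j hj
  have h2 := hwin q hq hqR q hq (by rw [dist_self]; exact hL) j hj
  exact h1.symm.trans h2

/-- ★ **Uniform verdict on the `ρ`-ball from a root-constant host verdict.**  Own-root verdicts (`hown`: `G j ↔ V q` for the site `j` matched to the
atom `q`), `V q ↔ V 0` on the atoms of `closedBall 0 R'`, every site within `ρ ≤ R` of `y i` matched to an atom (`hm2`), `ρ + ε ≤ R'`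
⇒ the `hflip` disjunction. [folklore: logic] -/
theorem uniformVerdict_of_rootConstant
    {S : Set (EuclideanSpace ℝ (Fin 3))} {V : EuclideanSpace ℝ (Fin 3) → Prop}
    {N : ℕ} {y : Fin N → EuclideanSpace ℝ (Fin 3)} {i : Fin N} {G : Fin N → Prop} {R ρ R' ε : ℝ}
    (hm2 : ∀ b : Fin N, dist (y b) (y i) ≤ R → ∃ q ∈ S, dist (y b - y i) (q - 0) ≤ ε)
    (hρR : ρ ≤ R) (hρR' : ρ + ε ≤ R')
    (hown : ∀ q ∈ S, ‖q‖ ≤ R' → ∀ j : Fin N, dist (y j - y i) (q - 0) ≤ ε → (G j ↔ V q))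
    (hconst : ∀ q ∈ S, ‖q‖ ≤ R' → (V q ↔ V 0)) :
    (∀ j : Fin N, dist (y j) (y i) ≤ ρ → G j) ∨ (∀ j : Fin N, dist (y j) (y i) ≤ ρ → ¬ G j) := by
  have atom : ∀ j : Fin N, dist (y j) (y i) ≤ ρ → ∃ q ∈ S, ‖q‖ ≤ R' ∧ dist (y j - y i) (q - 0) ≤ ε := by
    intro j hj
    obtain ⟨q, hq, hjq⟩ := hm2 j (hj.trans hρR)
    refine ⟨q, hq, ?_, hjq⟩
    have h1 : ‖q‖ ≤ ‖y j - y i‖ + dist (y j - y i) (q - 0) := by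
      have := norm_sub_le (y j - y i) ((y j - y i) - (q - 0))
      rw [sub_sub_cancel, sub_zero] at this
      rw [sub_zero, dist_eq_norm]; exact this
    rw [← dist_eq_norm] at h1
    linarith
  by_cases hV : V 0
  · left
    intro j hj
    obtain ⟨q, hq, hqR, hjq⟩ := atom j hj
    exact (hown q hq hqR j hjq).mpr ((hconst q hq hqR).mpr hV)
  · right
    intro j hj hG
    obtain ⟨q, hq, hqR, hjq⟩ := atom j hj
    exact hV ((hconst q hq hqR).mp ((hown q hq hqR j hjq).mp hG))

/-- ★ **`hflip` with `R' ≥ ρ + ε` from WINDOW VERDICTS and COVERING** — the composite of the three lemmas.  Hypotheses: `0 ∈ S`; two-way matching of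
`S ∩ closedBall 0 R` with the sites of `y` within `R` of `y i` (tolerance `ε`, as delivered by `Appr` at the root); radii `ρ ≤ R`, `ρ + ε ≤ R' ≤ R`,
`0 < h`, `0 ≤ c`; window verdicts at range `h + 2c` (`hwin`) and `c`-dense atoms within `h + c` of every atom of the `R'`-ball (`hcov`). [folklore] -/
theorem uniformVerdict_of_windowVerdict_of_cover
    {S : Set (EuclideanSpace ℝ (Fin 3))} {V : EuclideanSpace ℝ (Fin 3) → Prop}
    {N : ℕ} {y : Fin N → EuclideanSpace ℝ (Fin 3)} {i : Fin N} {G : Fin N → Prop} {R ρ R' ε h c : ℝ}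
    (h0 : (0 : EuclideanSpace ℝ (Fin 3)) ∈ S)
    (hm1 : ∀ q ∈ S, dist q (0 : EuclideanSpace ℝ (Fin 3)) ≤ R → ∃ b : Fin N, dist (y b - y i) (q - 0) ≤ ε)
    (hm2 : ∀ b : Fin N, dist (y b) (y i) ≤ R → ∃ q ∈ S, dist (y b - y i) (q - 0) ≤ ε)
    (hε : 0 ≤ ε) (hρ : 0 ≤ ρ) (hρR : ρ ≤ R) (hρR' : ρ + ε ≤ R') (hR'R : R' ≤ R) (hh : 0 < h) (hc : 0 ≤ c)
    (hwin : ∀ p ∈ S, ‖p‖ ≤ R' → ∀ q ∈ S, dist p q ≤ h + 2 * c → ∀ j : Fin N, dist (y j - y i) (q - 0) ≤ ε → (G j ↔ V p))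
    (hcov : ∀ q ∈ S, ‖q‖ ≤ R' → ∀ w : EuclideanSpace ℝ (Fin 3), dist w q ≤ h + c → ∃ p ∈ S, dist p w ≤ c) :
    (∀ j : Fin N, dist (y j) (y i) ≤ ρ → G j) ∨ (∀ j : Fin N, dist (y j) (y i) ≤ ρ → ¬ G j) := by
  have hL : (0 : ℝ) ≤ h + 2 * c := by linarith
  have hR' : 0 ≤ R' := by linarith
  have hloc := locallyConstant_of_windowVerdict hm1 hR'R hL hwin
  have hconst := iff_root_of_locallyConstant_of_cover hh hc h0 hR' hloc hcov
  exact uniformVerdict_of_rootConstant hm2 hρR hρR' (fun q hq hqR j hj => hwin q hq hqR q hq (by rw [dist_self]; exact hL) j hj) hconst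

end Summit.AtomisticToContinuum.Crystallization.Theorems.FrustratedLawDichotomyTexturePropagation

end
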